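import Summits.CriticalPhenomena.Ising3DConformalLimit.Theorems.LeeYangGapNearCriticalLeeYangGapSusceptibilityDoubling
import Literature.Probability.LatticeModels.TwoPointWindowLowerBound
import Literature.Probability.LatticeModels.SharpLengthCorrLength

/-!
# One-scale susceptibility comparability (stub S2χ₁): what is proved, and what it reduces to

Route `LeeYangGap` (Ising3DConformalLimit), crux `NearCriticalLeeYangGap` (GAP, item
stmt-CriticalPhenomena-4945), line `registered`, lead c5, wave on the registered stub **S2χ₁**
`stub_susceptibilityComparabilityOneScale`:

  `∃ r A β₂, 0 < r ∧ 0 < A ∧ β₂ < β_c ∧ ∀ β ∈ [β₂, β_c) ∀ n ≤ r ξ(β), χ_n(β_c) ≤ A χ(β)`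

(`χ_n(β_c) = Σ_{z ∈ Λ_n} ⟨σ₀σ_z⟩⁺_{β_c}` the critical box susceptibility, `χ(β) = susceptibility 3 β`,
`ξ(β) = isingCorrLength 3 β`; amplitude form of the Fisher half `γ ≥ (2-η)ν` at one scale). The stub is
NOT proved, assumed or restated as a theorem here: on `ℤ³` it needs a comparison of the near-critical
and the critical two-point functions below the correlation length ("inner criticality"), for which the
tree — and the literature — has only the two classical one-sided bounds, the infrared bound
`⟨σ₀σ_x⟩_{β_c} ≤ C/‖x‖` (exponent `d-2 = 1`) and the Simon-type lower bound `⟨σ₀σ_x⟩_β ≥ c/‖x‖²`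
(exponent `d-1 = 2`) below the sharp length. This file records, kernel-checked:

* `twoPointFree_ge_inv_sq_of_lt_sharpLength` — the near-critical pointwise lower bound on `ℤ³`:
  `⟨σ₀σ_x⟩^∅_β ≥ 1/(3528 β ‖x‖_∞²)` for `x ≠ 0`, `3‖x‖_∞ < L(β)` (`L` the Duminil-Copin–Panis sharp
  length; shell sums `≥ 1/(12β)` below `L(β)`, `shellSum_ge`, and both Messager–Miracle-Solé halves);
* `criticalTwoPoint_le_mul_norm_mul_twoPointFree_of_lt_sharpLength` / `…_window` — **inner
  criticality up to ONE power of the scale**: `⟨σ₀σ_x⟩⁺_{β_c} ≤ A ‖x‖_∞ ⟨σ₀σ_x⟩^∅_β` for `x ≠ 0` with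
  `3‖x‖_∞ < L(β)`, resp. `‖x‖_∞ ≤ r ξ(β)` (`ξ ≤ L/c_ξ`, `isingCorrLength_le_mul_sharpLength`);
* `criticalBoxSum_le_mul_scale_mul_boxSum` / `stub_oneScaleComparabilityUpToScale` (glue stub,
  registered on the item) — **S2χ₁ up to the factor `n + 1`**, unconditionally: `χ_n(β_c) ≤ (A n + 1) χ_n(β) ≤ A'(n+1) χ(β)` for
  `n ≤ r ξ(β)`, `β ∈ [β_c/2, β_c)` (the registered signature with `A` replaced by `A (n+1)`);
* `susceptibilityComparabilityOneScale_of_sharpLengthInnerCriticality` — S2χ₁ verbatim from inner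
  criticality in sharp-length units (`c ⟨σ₀σ_x⟩⁺_{β_c} ≤ ⟨σ₀σ_x⟩^∅_β` for `‖x‖_∞ ≤ r L(β)`,
  `β ∈ [β₀, β_c)`: the `d = 3` analogue of Duminil-Copin–Panis 2025 Thm 1.4 / Rem 1.7, open);
* `susceptibilityComparabilityOneScale_of_innerCriticality_sharpLengthWindow` — S2χ₁ verbatim from
  the two registered open stubs `stub_innerCriticality` ∧ `stub_sharpLengthWindow` of crux
  `CorrelationLengthWindow` (item stmt-CriticalPhenomena-6032; hypotheses copied character for
  character, so the registered `Registered.stub_*` abbreviations of that skeleton apply by `rfl`):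
  the formal dependency S2χ₁ ⇐ 6032(i) ∧ 6032(sharp-length window);
* `susceptibilityComparabilityOneScale_iff_floor` — S2χ₁ is equivalent to its diagonal instance
  `∃ A β₂, ∀ β ∈ [β₂, β_c), χ_{⌊ξ(β)⌋}(β_c) ≤ A χ(β)` (Messager–Miracle-Solé doubling,
  `susceptibilityComparability_of_oneScale`).

Why the factor `n` survives all in-tree tools (census, leads c2–c5): the infrared side would need
`χ(β) ≥ c ξ(β)²` (false if `η > 0`); the Simon side IS inner criticality; `∂_β`/Lebowitz/GHS
inequalities saturate at mean-field exponents; Griffiths monotonicity in `β` goes the wrong way.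

## References

* H. Duminil-Copin, R. Panis, CMP 406 (2025), arXiv:2404.05700, Def. 1.1, eq. (1.4), Thm 1.4,
  Rem 1.7 [DuminilCopinPanis2025LowerBounds]; B. Simon, CMP 77 (1980) 111–126 [Simon1980CMP].
* A. Messager, S. Miracle-Solé, J. Stat. Phys. 17 (1977) [MessagerMiracleSoleJSP1977];
  H. Duminil-Copin, Lectures on the Ising and Potts models (2019), Thm 4.8 [DuminilCopin2019];
  M. E. Fisher, Phys. Rev. 180 (1969) 594; S. Friedli, Y. Velenik (CUP 2017), §3.7.4 [FriedliVelenik2017].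
-/

noncomputable section

namespace Summit.CriticalPhenomena.Ising3DConformalLimit.LeeYangGapNearCriticalLeeYangGap

open Literature.Probability.LatticeModels Filter Set Finset
open scoped Topology BigOperators ENNReal
open Summit.CriticalPhenomena.Ising3DConformalLimit.LeeYangGapGaussianLimitKillsBlockCoupling (boxSum_mono)

/-! ### Near-critical pointwise lower bound inside the sharp length -/

/-- **Simon-type pointwise lower bound below the sharp length (`ℤ³`)**: for `β > 0` and `x ≠ 0`
with `3‖x‖_∞ < L(β)`, `⟨σ₀σ_x⟩^∅_β ≥ 1/(3528 β ‖x‖_∞²)`. The shell `∂Λ_{3‖x‖_∞}` carries at least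
`1/(12β)` (Duminil-Copin–Panis Def. 1.1 read on boxes, `shellSum_ge`), each of its
`≤ 294‖x‖_∞²` points is dominated by the axis value `⟨σ₀σ_{3‖x‖_∞ e₁}⟩^∅_β`, which in turn is
`≤ ⟨σ₀σ_x⟩^∅_β` (Messager–Miracle-Solé, both halves). -/
theorem twoPointFree_ge_inv_sq_of_lt_sharpLength {β : ℝ} (hβ : 0 < β) {x : Site 3} (hx : x ≠ 0)
    (hL : ((3 * Site.supNorm x : ℕ) : ℕ∞) < sharpLength 3 β) :
    1 / (3528 * β * (Site.supNorm x : ℝ) ^ 2) ≤ twoPointFree 3 β x := by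
  have h3 : (1 : ℕ) ≤ 3 := by norm_num
  set m : ℕ := Site.supNorm x with hm
  have hm1 : 1 ≤ m := Nat.one_le_iff_ne_zero.2 fun h => hx (Site.supNorm_eq_zero_iff.1 h)
  obtain ⟨k, hk⟩ : ∃ k : ℕ, 3 * m = k + 1 := ⟨3 * m - 1, by omega⟩
  rw [hk] at hL
  -- the shell sum at radius `k + 1 = 3m` is at least `1/(12β)`
  have hS : 1 / (12 * β) ≤ ∑ y ∈ sphere 3 (k + 1), twoPointFree 3 β y := by
    have h := shellSum_ge (d := 3) (by norm_num) hβ hL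
    have e : (4 : ℝ) * ((3 : ℕ) : ℝ) * β = 12 * β := by push_cast; ring
    rwa [e] at h
  -- every point of that shell is dominated by the axis value, itself dominated by `S(x)`
  have hdom : ∀ y ∈ sphere 3 (k + 1), twoPointFree 3 β y ≤ twoPointFree 3 β x := fun y hy =>
    (twoPointFree_le_single_of_le hβ.le h3 (s := k + 1) (by rw [mem_sphere.1 hy])).trans
      (twoPointFree_single_le_of_mul_le hβ.le h3 (x := x) (s := k + 1) (by omega))
  have hsum : ∑ y ∈ sphere 3 (k + 1), twoPointFree 3 β y ≤
      (#(sphere 3 (k + 1)) : ℝ) * twoPointFree 3 β x := by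
    rw [← nsmul_eq_mul, ← Finset.sum_const]
    exact Finset.sum_le_sum hdom
  -- `|∂Λ_{k+1}| ≤ 6 (2k+3)² = 6 (6m+1)² ≤ 294 m²`
  have hcard : (#(sphere 3 (k + 1)) : ℝ) ≤ 294 * (m : ℝ) ^ 2 := by
    have h := card_sphere_succ_le (d := 3) k
    have hkm : (2 * (k : ℝ) + 3) = 6 * m + 1 := by
      have : (2 * k + 3 : ℕ) = 6 * m + 1 := by omega
      exact_mod_cast this
    have hm1' : (1 : ℝ) ≤ m := by exact_mod_cast hm1
    norm_num at h
    rw [hkm] at h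
    nlinarith [h, hm1']
  have hSx : 0 ≤ twoPointFree 3 β x := twoPointFree_nonneg_of_nonneg hβ.le x
  have hmpos : (0 : ℝ) < m := by exact_mod_cast hm1
  rw [div_le_iff₀ (by positivity)]
  have h12 : 1 ≤ 12 * β * ((#(sphere 3 (k + 1)) : ℝ) * twoPointFree 3 β x) := by
    have := hS.trans hsum
    rwa [div_le_iff₀' (by positivity)] at this
  calc (1 : ℝ) ≤ 12 * β * ((#(sphere 3 (k + 1)) : ℝ) * twoPointFree 3 β x) := h12
    _ ≤ 12 * β * (294 * (m : ℝ) ^ 2 * twoPointFree 3 β x) := by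
        gcongr
    _ = twoPointFree 3 β x * (3528 * β * (m : ℝ) ^ 2) := by ring

/-! ### Comparability up to one power of the scale -/

/-- **Near-critical pointwise comparability up to one power of `‖x‖`, inside the sharp length**:
there is `A > 0` with `⟨σ₀σ_x⟩⁺_{β_c} ≤ A ‖x‖_∞ ⟨σ₀σ_x⟩^∅_β` for all `0 < β ≤ β_c(3)` and `x ≠ 0`
with `3‖x‖_∞ < L(β)` — the infrared bound `⟨σ₀σ_x⟩_{β_c} ≤ C/‖x‖` (`criticalTwoPoint_bounds_holds`)
against the Simon-type bound `⟨σ₀σ_x⟩^∅_β ≥ c/‖x‖²`; the lost power `‖x‖¹ = ‖x‖^{(d-1)-(d-2)}` is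
what inner criticality (the `d = 3` analogue of Duminil-Copin–Panis 2025 Thm 1.4) would remove. -/
theorem criticalTwoPoint_le_mul_norm_mul_twoPointFree_of_lt_sharpLength :
    ∃ A : ℝ, 0 < A ∧ ∀ β : ℝ, 0 < β → β ≤ criticalBeta 3 → ∀ x : Site 3, x ≠ 0 →
      ((3 * Site.supNorm x : ℕ) : ℕ∞) < sharpLength 3 β →
      twoPointPlus 3 (criticalBeta 3) x ≤ A * ‖x‖ * twoPointFree 3 β x := by
  obtain ⟨c, C, -, hB⟩ := criticalTwoPoint_bounds_holds (d := 3) le_rfl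
  have hβc : 0 < criticalBeta 3 := criticalBeta_pos_holds (d := 3) (by norm_num)
  set C' : ℝ := max C 1 with hC'
  have hC'1 : 1 ≤ C' := le_max_right _ _
  refine ⟨3528 * criticalBeta 3 * C', by positivity, fun β hβ hβle x hx hL => ?_⟩
  set m : ℕ := Site.supNorm x with hm
  have hm1 : 1 ≤ m := Nat.one_le_iff_ne_zero.2 fun h => hx (Site.supNorm_eq_zero_iff.1 h)
  have hmpos : (0 : ℝ) < m := by exact_mod_cast hm1
  -- infrared bound at `β_c`: `G_c(x) ≤ C'/m`
  have hIR : twoPointPlus 3 (criticalBeta 3) x ≤ C' * (m : ℝ)⁻¹ := by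
    have h := (hB x hx).2
    have he : -(((3 : ℕ) : ℝ) - 2) = (-1 : ℝ) := by norm_num
    rw [Site.norm_eq_supNorm, he, Real.rpow_neg_one] at h
    exact h.trans (mul_le_mul_of_nonneg_right (le_max_left C 1) (inv_nonneg.2 hmpos.le))
  -- Simon-type lower bound at `β`: `G_β(x) ≥ 1/(3528 β m²) ≥ 1/(3528 β_c m²)`
  have hlow := twoPointFree_ge_inv_sq_of_lt_sharpLength hβ hx hL
  rw [← hm] at hlow
  have hlow' : 1 / (3528 * criticalBeta 3 * (m : ℝ) ^ 2) ≤ twoPointFree 3 β x := by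
    refine le_trans ?_ hlow
    gcongr
  rw [Site.norm_eq_supNorm, ← hm]
  calc twoPointPlus 3 (criticalBeta 3) x ≤ C' * (m : ℝ)⁻¹ := hIR
    _ = 3528 * criticalBeta 3 * C' * (m : ℝ) * (1 / (3528 * criticalBeta 3 * (m : ℝ) ^ 2)) := by
        field_simp
    _ ≤ 3528 * criticalBeta 3 * C' * (m : ℝ) * twoPointFree 3 β x :=
        mul_le_mul_of_nonneg_left hlow' (by positivity)

/-- **The same in correlation-length units** ("inner criticality up to one power of the scale"):
`⟨σ₀σ_x⟩⁺_{β_c} ≤ A ‖x‖_∞ ⟨σ₀σ_x⟩^∅_β` for `0 < β < β_c(3)`, `x ≠ 0`, `‖x‖_∞ ≤ r ξ(β)`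
(`ξ(β) ≤ L(β)/c`, `isingCorrLength_le_mul_sharpLength`, so `r = c/4` puts `3‖x‖_∞` below `L(β)`). -/
theorem criticalTwoPoint_le_mul_norm_mul_twoPointFree_window :
    ∃ r A : ℝ, 0 < r ∧ 0 < A ∧ ∀ β : ℝ, 0 < β → β < criticalBeta 3 → ∀ x : Site 3, x ≠ 0 →
      ‖x‖ ≤ r * isingCorrLength 3 β →
      twoPointPlus 3 (criticalBeta 3) x ≤ A * ‖x‖ * twoPointFree 3 β x := by
  obtain ⟨Cξ, hCξ, hξ⟩ := isingCorrLength_le_mul_sharpLength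
  obtain ⟨A, hA, hcomp⟩ := criticalTwoPoint_le_mul_norm_mul_twoPointFree_of_lt_sharpLength
  refine ⟨1 / (4 * Cξ), A, by positivity, hA, fun β hβ hβc x hx hxr => hcomp β hβ hβc.le x hx ?_⟩
  obtain ⟨ℓ, hℓ, hℓ1, -, -⟩ := exists_sharpLength_eq hβ hβc
  have hξℓ : isingCorrLength 3 β ≤ Cξ * ℓ := hξ β hβ hβc ℓ hℓ
  have hm : (Site.supNorm x : ℝ) ≤ 1 / (4 * Cξ) * (Cξ * ℓ) := by
    rw [← Site.norm_eq_supNorm]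
    exact hxr.trans (mul_le_mul_of_nonneg_left hξℓ (by positivity))
  have hm' : (4 : ℝ) * Site.supNorm x ≤ ℓ := by
    have e : 1 / (4 * Cξ) * (Cξ * (ℓ : ℝ)) = ℓ / 4 := by field_simp
    rw [e] at hm
    linarith
  have hlt : 3 * Site.supNorm x < ℓ := by
    have h1 : 1 ≤ Site.supNorm x :=
      Nat.one_le_iff_ne_zero.2 fun h => hx (Site.supNorm_eq_zero_iff.1 h)
    have : ((4 * Site.supNorm x : ℕ) : ℝ) ≤ ℓ := by push_cast; exact hm'
    have h4 : 4 * Site.supNorm x ≤ ℓ := by exact_mod_cast this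
    omega
  rw [hℓ]
  exact_mod_cast hlt

/-- **S2χ₁ up to one power of the scale, box to box**: for `0 < β < β_c(3)` and `n ≤ r ξ(β)`,
`Σ_{z ∈ Λ_n} ⟨σ₀σ_z⟩⁺_{β_c} ≤ (A n + 1) Σ_{z ∈ Λ_n} ⟨σ₀σ_z⟩^∅_β` (the critical and the near-critical
box susceptibilities at one scale agree up to the factor `n`; the origin gives the `+1`). -/
theorem criticalBoxSum_le_mul_scale_mul_boxSum :
    ∃ r A : ℝ, 0 < r ∧ 0 < A ∧ ∀ β : ℝ, 0 < β → β < criticalBeta 3 → ∀ n : ℕ,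
      (n : ℝ) ≤ r * isingCorrLength 3 β →
      ∑ z ∈ box 3 n, twoPointPlus 3 (criticalBeta 3) z ≤
        (A * n + 1) * ∑ z ∈ box 3 n, twoPointFree 3 β z := by
  obtain ⟨r, A, hr, hA, hcomp⟩ := criticalTwoPoint_le_mul_norm_mul_twoPointFree_window
  refine ⟨r, A, hr, hA, fun β hβ hβc n hn => ?_⟩
  rw [Finset.mul_sum]
  refine Finset.sum_le_sum fun z hz => ?_
  have hzn : Site.supNorm z ≤ n := mem_box_iff_supNorm_le.1 hz
  have hG0 : 0 ≤ twoPointFree 3 β z := twoPointFree_nonneg_of_nonneg hβ.le z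
  have hn0 : (0 : ℝ) ≤ A * n + 1 := by positivity
  by_cases hz0 : z = 0
  · subst hz0
    rw [twoPointPlus_zero, twoPointFree_zero']
    have : (0 : ℝ) ≤ A * n := by positivity
    linarith
  · have hnorm : ‖z‖ ≤ r * isingCorrLength 3 β := by
      rw [Site.norm_eq_supNorm]
      exact le_trans (by exact_mod_cast hzn) hn
    calc twoPointPlus 3 (criticalBeta 3) z ≤ A * ‖z‖ * twoPointFree 3 β z := hcomp β hβ hβc z hz0 hnorm
      _ ≤ A * n * twoPointFree 3 β z := by
          refine mul_le_mul_of_nonneg_right (mul_le_mul_of_nonneg_left ?_ hA.le) hG0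
          rw [Site.norm_eq_supNorm]
          exact_mod_cast hzn
      _ ≤ (A * n + 1) * twoPointFree 3 β z := by nlinarith

/-- **S2χ₁ up to one power of the scale** (glue stub `stub_oneScaleComparabilityUpToScale` of item
stmt-CriticalPhenomena-4945: the signature of S2χ₁ with `A` replaced by `A (n + 1)`): there are
`r, A > 0` and `β₂ < β_c(3)` with `Σ_{z ∈ Λ_n} ⟨σ₀σ_z⟩⁺_{β_c} ≤ A (n + 1) χ(β)` for all `β ∈ [β₂, β_c)`
and `n ≤ r ξ(β)`. Unconditional; the registered stub S2χ₁ `stub_susceptibilityComparabilityOneScale`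
is the same WITHOUT the factor `n + 1`, and is not asserted here. -/
theorem stub_oneScaleComparabilityUpToScale :
    ∃ r A β₂ : ℝ, 0 < r ∧ 0 < A ∧ β₂ < Literature.Probability.LatticeModels.criticalBeta 3 ∧
      ∀ β : ℝ, β₂ ≤ β → β < Literature.Probability.LatticeModels.criticalBeta 3 → ∀ n : ℕ,
        (n : ℝ) ≤ r * Literature.Probability.LatticeModels.isingCorrLength 3 β →
        ∑ z ∈ Literature.Probability.LatticeModels.box 3 n,
            Literature.Probability.LatticeModels.twoPointPlus 3
              (Literature.Probability.LatticeModels.criticalBeta 3) z ≤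
          A * ((n : ℝ) + 1) * (Literature.Probability.LatticeModels.susceptibility 3 β).toReal := by
  obtain ⟨r, A, hr, hA, hbox⟩ := criticalBoxSum_le_mul_scale_mul_boxSum
  have hβc : 0 < criticalBeta 3 := criticalBeta_pos_holds (d := 3) (by norm_num)
  refine ⟨r, A + 1, criticalBeta 3 / 2, hr, by positivity, by linarith, fun β hβ₂ hβlt n hn => ?_⟩
  have hβ : 0 < β := by linarith
  have hχ := sum_box_twoPointFree_le_susceptibility_toReal hβ.le hβlt n
  have hS0 : 0 ≤ ∑ z ∈ box 3 n, twoPointFree 3 β z :=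
    Finset.sum_nonneg fun z _ => twoPointFree_nonneg_of_nonneg hβ.le z
  have hχ0 : 0 ≤ (susceptibility 3 β).toReal := ENNReal.toReal_nonneg
  calc ∑ z ∈ box 3 n, twoPointPlus 3 (criticalBeta 3) z
      ≤ (A * n + 1) * ∑ z ∈ box 3 n, twoPointFree 3 β z := hbox β hβ hβlt n hn
    _ ≤ (A * n + 1) * (susceptibility 3 β).toReal := mul_le_mul_of_nonneg_left hχ (by positivity)
    _ ≤ (A + 1) * ((n : ℝ) + 1) * (susceptibility 3 β).toReal := by
        refine mul_le_mul_of_nonneg_right ?_ hχ0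
        have hn0 : (0 : ℝ) ≤ n := Nat.cast_nonneg n
        nlinarith

/-! ### The reduction to inner criticality in sharp-length units -/

/-- **S2χ₁ from inner criticality below the sharp length.** If for some `c, r > 0` and `β₀ < β_c`
the near-critical two-point function dominates the critical one inside `r L(β)`,
`c ⟨σ₀σ_x⟩⁺_{β_c} ≤ ⟨σ₀σ_x⟩^∅_β` for `β ∈ [β₀, β_c)`, `L(β) = ℓ`, `‖x‖_∞ ≤ r ℓ` — the `d = 3` analogue
of Duminil-Copin–Panis 2025 Thm 1.4 / Rem 1.7 (`d ≥ 5`), open on `ℤ³` (cf. `stub_innerCriticality` of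
crux `CorrelationLengthWindow`, item stmt-CriticalPhenomena-6032, stated in `ξ₂`-units) — then the
registered one-scale comparability S2χ₁ holds verbatim (with `A = 1/c` and window `r·c_ξ` in
`ξ`-units, `ξ(β) ≤ L(β)/c_ξ` by `isingCorrLength_le_mul_sharpLength`). -/
theorem susceptibilityComparabilityOneScale_of_sharpLengthInnerCriticality
    (h : ∃ c r β₀ : ℝ, 0 < c ∧ 0 < r ∧ β₀ < criticalBeta 3 ∧
      ∀ β : ℝ, β₀ ≤ β → β < criticalBeta 3 → ∀ ℓ : ℕ, sharpLength 3 β = ℓ →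
        ∀ x : Site 3, ‖x‖ ≤ r * ℓ →
          c * twoPointPlus 3 (criticalBeta 3) x ≤ twoPointFree 3 β x) :
    ∃ r A β₂ : ℝ, 0 < r ∧ 0 < A ∧ β₂ < criticalBeta 3 ∧
      ∀ β : ℝ, β₂ ≤ β → β < criticalBeta 3 → ∀ n : ℕ,
        (n : ℝ) ≤ r * isingCorrLength 3 β →
        ∑ z ∈ box 3 n, twoPointPlus 3 (criticalBeta 3) z ≤ A * (susceptibility 3 β).toReal := by
  obtain ⟨c, r, β₀, hc, hr, hβ₀, H⟩ := h
  obtain ⟨Cξ, hCξ, hξ⟩ := isingCorrLength_le_mul_sharpLength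
  have hβc : 0 < criticalBeta 3 := criticalBeta_pos_holds (d := 3) (by norm_num)
  set β₁ : ℝ := max β₀ (criticalBeta 3 / 2) with hβ₁
  have hβ₁c : β₁ < criticalBeta 3 := max_lt hβ₀ (by linarith)
  have hβ₁pos : 0 < β₁ := lt_of_lt_of_le (by linarith) (le_max_right _ _)
  have Hpt : ∀ β : ℝ, β₁ ≤ β → β < criticalBeta 3 → ∀ z : Site 3,
      ‖z‖ ≤ r / Cξ * isingCorrLength 3 β →
      twoPointPlus 3 (criticalBeta 3) z ≤ 1 / c * twoPointFree 3 β z := by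
    intro β hβ₁β hβlt z hz
    have hβ : 0 < β := hβ₁pos.trans_le hβ₁β
    obtain ⟨ℓ, hℓ, -, -, -⟩ := exists_sharpLength_eq hβ hβlt
    have hzℓ : ‖z‖ ≤ r * ℓ := by
      calc ‖z‖ ≤ r / Cξ * isingCorrLength 3 β := hz
        _ ≤ r / Cξ * (Cξ * ℓ) := mul_le_mul_of_nonneg_left (hξ β hβ hβlt ℓ hℓ) (by positivity)
        _ = r * ℓ := by field_simp
    rw [one_div, le_inv_mul_iff₀ hc]
    exact H β ((le_max_left _ _).trans hβ₁β) hβlt ℓ hℓ z hzℓ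
  refine ⟨r / Cξ, 1 / c, max β₁ 0, by positivity, by positivity, max_lt hβ₁c hβc, ?_⟩
  exact boxSum_le_of_twoPoint_le (by positivity) Hpt

/-- **S2χ₁ from the two open stubs of crux `CorrelationLengthWindow` (item stmt-CriticalPhenomena-6032).**
The hypotheses are, verbatim, the registered stubs `stub_innerCriticality` (INNER CRITICALITY:
`G_β(x) ≥ (1-ε) ⟨σ₀σ_x⟩_{β_c}` whenever `|x|₂² χ(β) ≤ s M₂(β)`, i.e. inside `√s·ξ₂(β)`) and
`stub_sharpLengthWindow` (`L(β) ≤ ℓ` with `ℓ² χ(β) ≤ A₀ M₂(β)`, i.e. the sharp length lies inside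
`√A₀·ξ₂(β)`) of that crux's birth skeleton (`G = twoPointFree 3`, `χ β = Σ' G β`,
`M₂ β = Σ' |x|₂² G β`, real `tsum`s). Together with `ξ(β) ≤ L(β)/c_ξ`
(`isingCorrLength_le_mul_sharpLength`) they put the window `‖x‖_∞ ≤ r ξ(β)`,
`r = √(s/(3(A₀ ∨ 1)))·c_ξ`, inside `√s·ξ₂(β)` (`|x|₂² ≤ 3‖x‖_∞²`); inner criticality at `ε = 1/2`
and `boxSum_le_of_twoPoint_le` then yield S2χ₁ with `A = 2`. Neither hypothesis is asserted here. -/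
theorem susceptibilityComparabilityOneScale_of_innerCriticality_sharpLengthWindow
    (hIC : let G : ℝ → Site 3 → ℝ := twoPointFree 3; let r2 : Site 3 → ℝ := (fun x : Site 3 => ∑ i, ((x i : ℝ)) ^ 2); let χ : ℝ → ℝ := fun β => ∑' x : Site 3, G β x; let M₂ : ℝ → ℝ := fun β => ∑' x : Site 3, r2 x * G β x; (∀ ε : ℝ, 0 < ε → ∃ s : ℝ, 0 < s ∧ ∃ β₀ : ℝ, β₀ < criticalBeta 3 ∧ ∀ β : ℝ, β₀ ≤ β → β < criticalBeta 3 → ∀ x : Site 3, r2 x * χ β ≤ s * M₂ β → (1 - ε) * criticalTwoPoint 3 x ≤ G β x))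
    (hSLW : let G : ℝ → Site 3 → ℝ := twoPointFree 3; let r2 : Site 3 → ℝ := (fun x : Site 3 => ∑ i, ((x i : ℝ)) ^ 2); let χ : ℝ → ℝ := fun β => ∑' x : Site 3, G β x; let M₂ : ℝ → ℝ := fun β => ∑' x : Site 3, r2 x * G β x; (∃ A₀ : ℝ, ∃ β₀ : ℝ, β₀ < criticalBeta 3 ∧ ∀ β : ℝ, β₀ ≤ β → β < criticalBeta 3 → ∃ ℓ : ℕ, sharpLength 3 β ≤ (ℓ : ℕ∞) ∧ ((ℓ : ℝ)) ^ 2 * χ β ≤ A₀ * M₂ β)) :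
    ∃ r A β₂ : ℝ, 0 < r ∧ 0 < A ∧ β₂ < criticalBeta 3 ∧
      ∀ β : ℝ, β₂ ≤ β → β < criticalBeta 3 → ∀ n : ℕ,
        (n : ℝ) ≤ r * isingCorrLength 3 β →
        ∑ z ∈ box 3 n, twoPointPlus 3 (criticalBeta 3) z ≤ A * (susceptibility 3 β).toReal := by
  obtain ⟨s, hs, β₀, hβ₀, HIC⟩ := hIC (1 / 2) (by norm_num)
  obtain ⟨A₀, β₀', hβ₀', HSLW⟩ := hSLW
  obtain ⟨Cξ, hCξ, hξ⟩ := isingCorrLength_le_mul_sharpLength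
  have hβc : 0 < criticalBeta 3 := criticalBeta_pos_holds (d := 3) (by norm_num)
  set A₁ : ℝ := max A₀ 1 with hA₁
  have hA₁pos : 0 < A₁ := lt_of_lt_of_le one_pos (le_max_right _ _)
  set ρ : ℝ := Real.sqrt (s / (3 * A₁)) with hρ
  have hρpos : 0 < ρ := Real.sqrt_pos.2 (by positivity)
  have hρsq : ρ ^ 2 = s / (3 * A₁) := Real.sq_sqrt (by positivity)
  set β₁ : ℝ := max (max β₀ β₀') (criticalBeta 3 / 2) with hβ₁
  have hβ₁c : β₁ < criticalBeta 3 := max_lt (max_lt hβ₀ hβ₀') (by linarith)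
  have hβ₁pos : 0 < β₁ := lt_of_lt_of_le (by linarith) (le_max_right _ _)
  -- pointwise comparability inside `ρ/Cξ · ξ(β)`
  have Hpt : ∀ β : ℝ, β₁ ≤ β → β < criticalBeta 3 → ∀ z : Site 3,
      ‖z‖ ≤ ρ / Cξ * isingCorrLength 3 β →
      twoPointPlus 3 (criticalBeta 3) z ≤ 2 * twoPointFree 3 β z := by
    intro β hβ₁β hβlt z hz
    have hβ : 0 < β := hβ₁pos.trans_le hβ₁β
    have hβ₀β : β₀ ≤ β := ((le_max_left _ _).trans (le_max_left _ _)).trans hβ₁β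
    have hβ₀'β : β₀' ≤ β := ((le_max_right _ _).trans (le_max_left _ _)).trans hβ₁β
    obtain ⟨ℓ₀, hℓ₀, -, -, -⟩ := exists_sharpLength_eq hβ hβlt
    obtain ⟨ℓ, hLℓ, hℓ⟩ := HSLW β hβ₀'β hβlt
    have hℓ₀ℓ : (ℓ₀ : ℝ) ≤ ℓ := by
      rw [hℓ₀] at hLℓ
      exact_mod_cast hLℓ
    -- `‖z‖ ≤ ρ ℓ`
    have hzℓ : ‖z‖ ≤ ρ * ℓ := by
      calc ‖z‖ ≤ ρ / Cξ * isingCorrLength 3 β := hz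
        _ ≤ ρ / Cξ * (Cξ * ℓ₀) := mul_le_mul_of_nonneg_left (hξ β hβ hβlt ℓ₀ hℓ₀) (by positivity)
        _ = ρ * ℓ₀ := by field_simp
        _ ≤ ρ * ℓ := mul_le_mul_of_nonneg_left hℓ₀ℓ hρpos.le
    -- `|z|₂² ≤ 3 ‖z‖² ≤ 3 ρ² ℓ² = (s/A₁) ℓ²`
    have hr2 : (∑ i, ((z i : ℝ)) ^ 2) ≤ s / A₁ * (ℓ : ℝ) ^ 2 := by
      have hcoord : ∀ i, ((z i : ℝ)) ^ 2 ≤ ‖z‖ ^ 2 := fun i => by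
        have h1 : |(z i : ℝ)| ≤ ‖z‖ := by
          have := norm_le_pi_norm z i
          rwa [Int.norm_eq_abs] at this
        calc ((z i : ℝ)) ^ 2 = |(z i : ℝ)| ^ 2 := (sq_abs _).symm
          _ ≤ ‖z‖ ^ 2 := pow_le_pow_left₀ (abs_nonneg _) h1 2
      calc (∑ i, ((z i : ℝ)) ^ 2) ≤ ∑ _i : Fin 3, ‖z‖ ^ 2 := Finset.sum_le_sum fun i _ => hcoord i
        _ = 3 * ‖z‖ ^ 2 := by rw [Finset.sum_const, Finset.card_univ, Fintype.card_fin]; ring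
        _ ≤ 3 * (ρ * ℓ) ^ 2 := by
            gcongr
        _ = s / A₁ * (ℓ : ℝ) ^ 2 := by rw [mul_pow, hρsq]; field_simp
    -- hence the window condition of inner criticality
    have hχ0 : 0 ≤ ∑' x : Site 3, twoPointFree 3 β x :=
      tsum_nonneg fun x => twoPointFree_nonneg_of_nonneg hβ.le x
    have hM0 : 0 ≤ ∑' x : Site 3, (∑ i, ((x i : ℝ)) ^ 2) * twoPointFree 3 β x :=
      tsum_nonneg fun x => mul_nonneg (Finset.sum_nonneg fun i _ => sq_nonneg _)
        (twoPointFree_nonneg_of_nonneg hβ.le x)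
    have hwin : (∑ i, ((z i : ℝ)) ^ 2) * (∑' x : Site 3, twoPointFree 3 β x) ≤
        s * ∑' x : Site 3, (∑ i, ((x i : ℝ)) ^ 2) * twoPointFree 3 β x := by
      calc (∑ i, ((z i : ℝ)) ^ 2) * (∑' x : Site 3, twoPointFree 3 β x)
          ≤ s / A₁ * (ℓ : ℝ) ^ 2 * (∑' x : Site 3, twoPointFree 3 β x) :=
            mul_le_mul_of_nonneg_right hr2 hχ0
        _ = s / A₁ * ((ℓ : ℝ) ^ 2 * ∑' x : Site 3, twoPointFree 3 β x) := by ring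
        _ ≤ s / A₁ * (A₀ * ∑' x : Site 3, (∑ i, ((x i : ℝ)) ^ 2) * twoPointFree 3 β x) :=
            mul_le_mul_of_nonneg_left hℓ (by positivity)
        _ ≤ s / A₁ * (A₁ * ∑' x : Site 3, (∑ i, ((x i : ℝ)) ^ 2) * twoPointFree 3 β x) :=
            mul_le_mul_of_nonneg_left (mul_le_mul_of_nonneg_right (le_max_left _ _) hM0)
              (by positivity)
        _ = s * ∑' x : Site 3, (∑ i, ((x i : ℝ)) ^ 2) * twoPointFree 3 β x := by field_simp
    have hmain := HIC β hβ₀β hβlt z hwin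
    change (1 - 1 / 2) * twoPointPlus 3 (criticalBeta 3) z ≤ twoPointFree 3 β z at hmain
    linarith
  refine ⟨ρ / Cξ, 2, max β₁ 0, by positivity, two_pos, max_lt hβ₁c hβc, ?_⟩
  exact boxSum_le_of_twoPoint_le two_pos Hpt

/-! ### The single-sequence (Fisher) form of S2χ₁ -/

/-- **S2χ₁ ⟺ `χ(β) ≥ c χ_{⌊ξ(β)⌋}(β_c)` near `β_c`.** The registered one-scale comparability is
equivalent to its diagonal instance `n = ⌊ξ(β)⌋`: `∃ A > 0, ∃ β₂ < β_c, ∀ β ∈ [β₂, β_c),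
Σ_{z ∈ Λ_{⌊ξ(β)⌋}} ⟨σ₀σ_z⟩⁺_{β_c} ≤ A χ(β)` (amplitude form of Fisher's `γ ≥ (2-η)ν`): `⇒` by the
Messager–Miracle-Solé upgrade to window constant `1` (`susceptibilityComparability_of_oneScale`),
`⇐` with `r = 1` by monotonicity of the box sum in `n`. -/
theorem susceptibilityComparabilityOneScale_iff_floor :
    (∃ r A β₂ : ℝ, 0 < r ∧ 0 < A ∧ β₂ < criticalBeta 3 ∧
      ∀ β : ℝ, β₂ ≤ β → β < criticalBeta 3 → ∀ n : ℕ,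
        (n : ℝ) ≤ r * isingCorrLength 3 β →
        ∑ z ∈ box 3 n, twoPointPlus 3 (criticalBeta 3) z ≤ A * (susceptibility 3 β).toReal) ↔
    (∃ A β₂ : ℝ, 0 < A ∧ β₂ < criticalBeta 3 ∧
      ∀ β : ℝ, β₂ ≤ β → β < criticalBeta 3 →
        ∑ z ∈ box 3 ⌊isingCorrLength 3 β⌋₊, twoPointPlus 3 (criticalBeta 3) z ≤
          A * (susceptibility 3 β).toReal) := by
  have hβc : 0 < criticalBeta 3 := criticalBeta_pos_holds (d := 3) (by norm_num)
  constructor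
  · rintro ⟨r, A, β₂, hr, hA, hβ₂, H⟩
    obtain ⟨A', β₂', hA', hβ₂', H'⟩ := susceptibilityComparability_of_oneScale hr hA hβ₂ H 1 one_pos
    refine ⟨A', max β₂' (criticalBeta 3 / 2), hA', max_lt hβ₂' (by linarith), fun β hβ hβlt => ?_⟩
    have hβpos : 0 < β := lt_of_lt_of_le (by linarith) ((le_max_right _ _).trans hβ)
    refine H' β ((le_max_left _ _).trans hβ) hβlt _ ?_
    rw [one_mul]
    exact Nat.floor_le (isingCorrLength_pos hβpos hβlt).le
  · rintro ⟨A, β₂, hA, hβ₂, H⟩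
    refine ⟨1, A, β₂, one_pos, hA, hβ₂, fun β hβ hβlt n hn => ?_⟩
    rw [one_mul] at hn
    have hnle : n ≤ ⌊isingCorrLength 3 β⌋₊ := Nat.le_floor hn
    calc ∑ z ∈ box 3 n, twoPointPlus 3 (criticalBeta 3) z
        = ∑ z ∈ box 3 n, criticalTwoPoint 3 z := rfl
      _ ≤ ∑ z ∈ box 3 ⌊isingCorrLength 3 β⌋₊, criticalTwoPoint 3 z := boxSum_mono hnle
      _ ≤ A * (susceptibility 3 β).toReal := H β hβ hβlt

end Summit.CriticalPhenomena.Ising3DConformalLimit.LeeYangGapNearCriticalLeeYangGap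

end
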